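import Mathlib
import HarnessLib
import Literature.MeasureTheory.Integral.RegionBetweenIntegral

/-!
# Integrals over a triangle as box integrals: the affine map onto `convexHull ℝ {a, b, c}` and Duffy's collapse

**Statement.** For three points `a b c : ℝ × ℝ` let `D = triangleDet a b c = (b₁ - a₁)(c₂ - b₂) - (c₁ - b₁)(b₂ - a₂)`
(twice the signed area). For every `f : ℝ × ℝ → ℝ` integrable on the (closed, possibly degenerate) triangle
`convexHull ℝ {a, b, c}`,

* `∫ p in convexHull ℝ {a, b, c}, f p = |D| * ∫ s in 0..1, ∫ t in 0..s, f (a + s • (b - a) + t • (c - b))`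
  (`setIntegral_convexHull_triple_eq_iterated`) — the nonsingular affine change of variables with constant Jacobian
  `|D|` of Davis–Rabinowitz (5.4.7)–(5.4.8), composed with Fubini over the unit triangle `0 ≤ t ≤ s ≤ 1`;
* `∫ p in convexHull ℝ {a, b, c}, f p = |D| * ∫ u in 0..1, ∫ v in 0..1, u * f (a + u • (b - a) + (u * v) • (c - b))`
  (`setIntegral_convexHull_triple_eq_iterated_duffy`) — Duffy's collapse `t = u v` of the unit square onto the unit
  triangle (Jacobian `u`), which turns the triangle into the BOX `[0, 1]²` with a polynomially weighted integrand;
* the degenerate case `D = 0` gives `0` on both sides (`setIntegral_convexHull_triple_of_det_eq_zero`, the triangle is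
  a null set), so the two headline formulas carry NO non-degeneracy hypothesis; `_of_continuousOn` corollaries drop the
  integrability hypothesis; `volume_convexHull_triple_prod` is the area `|D| / 2`.

On the way: the unit triangle `unitTriangle = {(s, t) | 0 ≤ t ≤ s ≤ 1}` as a `closedRegionBetween` (so that the
`RegionBetweenIntegral` Fubini theorem applies), the affine parametrisation `triangleParam a b c (s, t) =
a + s • (b - a) + t • (c - b)` with derivative `triangleLinear a b c` of determinant `D`, its injectivity for `D ≠ 0`,
and `triangleParam a b c '' unitTriangle = convexHull ℝ {a, b, c}` (via `convexHull_insert` / `convexJoin`).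

**Why here.** Certified cubature engines integrate over boxes; a triangle (and hence, by triangulation and
additivity, any polygon) is reduced to the unit square by these two classical maps. The tree had the axis-aligned
special case only (`Literature.Analysis.ValidatedNumerics.TaylorModelIntegralCert2DVertex`, Part B: a rectangle cut
along its diagonal); the general-vertex statement over `convexHull ℝ {a, b, c}` with the `|det|` factor, the null
degenerate case and the box forms for INTEGRALS are new in the tree; the AREA formula alone exists for
`EuclideanSpace ℝ (Fin 2)` as `Literature.MathematicalPhysics.StatisticalMechanics.Theil2006.volume_convexHull_triple`
(standard-simplex parametrisation) — `volume_convexHull_triple_prod` below is its `ℝ × ℝ` counterpart in collapsed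
coordinates, kept because the integral theorems need the null degenerate case on `ℝ × ℝ`. Mathlib supplies the
change-of-variables theorem (`MeasureTheory.integral_image_eq_integral_abs_det_fderiv_smul`) and
`Measure.addHaar_image_continuousLinearMap`.

Honest framing: this is infrastructure for shared numerical engines serving client cells; rigour lives in the
verifiers (the kernel-checked certificate that consumes the box form); every published number belongs to a client
cell's ledger, not to the engines group. Nothing here is claimed as new mathematics.

References: P. J. Davis, P. Rabinowitz, *Methods of Numerical Integration*, 2nd ed. (1984), Sect. 5.2 (5.2.1)
(the standard simplex), Sect. 5.4 (5.4.7)–(5.4.8) (affine change of variables, constant Jacobian `|ae - bd|`),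
Sect. 5.6.1 (5.6.1.1) (iterated integrals over elementary regions), Sect. 5.8 (Duffy's transformation for simplexes);
M. G. Duffy, *Quadrature over a pyramid or cube of integrands with a singularity at a vertex*, SIAM J. Numer. Anal. 19
(1982), p. 1260; J. F. Hurley, *Intermediate Calculus* (1980), Sect. 5.3 (3).

AI-produced formalisation (H21 engines group, seat eng-quad-3 gen 66, 2026-08-24); Lean 4 + Mathlib, no `sorry`,
standard axioms only.
-/

open _root_.MeasureTheory Set intervalIntegral
open scoped Interval

noncomputable section

namespace Literature.MeasureTheory.Integral

/-! ### The unit triangle `0 ≤ t ≤ s ≤ 1` -/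

/-- The unit triangle in collapsed coordinates: `{(s, t) | 0 ≤ t ≤ s ≤ 1}`, the part of the unit square under the
diagonal (the image of Davis–Rabinowitz's standard simplex `S₂` under `(x, y) ↦ (x + y, y)`).
[cite: DavisRabinowitz1984, Sect. 5.2 (5.2.1)] -/
def unitTriangle : Set (ℝ × ℝ) := {q : ℝ × ℝ | 0 ≤ q.2 ∧ q.2 ≤ q.1 ∧ q.1 ≤ 1}

/-- Membership in the unit triangle. [cite: DavisRabinowitz1984, Sect. 5.2 (5.2.1)] -/
theorem mem_unitTriangle {q : ℝ × ℝ} : q ∈ unitTriangle ↔ 0 ≤ q.2 ∧ q.2 ≤ q.1 ∧ q.1 ≤ 1 := Iff.rfl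

/-- The unit triangle is the closed region between the graphs of `0` and `id` over `[0, 1]`.
[cite: Hurley1980, Sect. 5.3 (3)] -/
theorem unitTriangle_eq_closedRegionBetween : unitTriangle = closedRegionBetween (fun _ => 0) id (Icc 0 1) := by
  ext q
  simp only [mem_unitTriangle, mem_closedRegionBetween, mem_Icc, id]
  constructor
  · rintro ⟨h1, h2, h3⟩
    exact ⟨⟨h1.trans h2, h3⟩, h1, h2⟩
  · rintro ⟨⟨_, h3⟩, h1, h2⟩
    exact ⟨h1, h2, h3⟩

/-- The unit triangle is measurable. [cite: DavisRabinowitz1984, Sect. 5.2 (5.2.1)] -/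
theorem measurableSet_unitTriangle : MeasurableSet unitTriangle := by
  rw [unitTriangle_eq_closedRegionBetween]
  exact measurableSet_closedRegionBetween measurable_const measurable_id measurableSet_Icc

/-- The unit triangle is compact. [cite: DavisRabinowitz1984, Sect. 5.2 (5.2.1)] -/
theorem isCompact_unitTriangle : IsCompact unitTriangle := by
  rw [unitTriangle_eq_closedRegionBetween]
  exact isCompact_closedRegionBetween continuousOn_const continuousOn_id

/-- The unit triangle lies in the unit square. [cite: DavisRabinowitz1984, Sect. 5.2 (5.2.1)] -/
theorem unitTriangle_subset_Icc_prod : unitTriangle ⊆ Icc (0 : ℝ) 1 ×ˢ Icc (0 : ℝ) 1 :=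
  fun _ ⟨h1, h2, h3⟩ => ⟨⟨h1.trans h2, h3⟩, h1, h2.trans h3⟩

/-- A function continuous on the unit triangle is integrable on it. [cite: DavisRabinowitz1984, Sect. 5.2 (5.2.1)] -/
theorem _root_.ContinuousOn.integrableOn_unitTriangle {g : ℝ × ℝ → ℝ} (hg : ContinuousOn g unitTriangle) :
    IntegrableOn g unitTriangle :=
  hg.integrableOn_compact isCompact_unitTriangle

/-- **Fubini on the unit triangle**: `∫ q in unitTriangle, g q = ∫ s in 0..1, ∫ t in 0..s, g (s, t)` for `g`
integrable on it (Davis–Rabinowitz (5.6.1.1) with `d = 2`, limits `0 ≤ x₂ ≤ x₁`).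
[cite: DavisRabinowitz1984, Sect. 5.6.1 (5.6.1.1)] [cite: Hurley1980, Sect. 5.3 (3)] -/
theorem setIntegral_unitTriangle_eq_iterated {g : ℝ × ℝ → ℝ} (hg : IntegrableOn g unitTriangle) :
    ∫ q in unitTriangle, g q = ∫ s in (0:ℝ)..1, ∫ t in (0:ℝ)..s, g (s, t) := by
  rw [unitTriangle_eq_closedRegionBetween] at hg ⊢
  exact setIntegral_closedRegionBetween_eq_iterated zero_le_one measurable_const measurable_id
    (fun x hx => hx.1) hg

/-- **Duffy's collapse on one fibre**: `∫ t in 0..s, g (s, t) = ∫ v in 0..1, s * g (s, s * v)` (the substitution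
`t = s v`, Jacobian `s`; no hypothesis on `g` or on the sign of `s`). [cite: Duffy1982, p. 1260]
[cite: DavisRabinowitz1984, Sect. 5.8] -/
theorem integral_fibre_eq_integral_duffy (g : ℝ × ℝ → ℝ) (s : ℝ) :
    ∫ t in (0:ℝ)..s, g (s, t) = ∫ v in (0:ℝ)..1, s * g (s, s * v) := by
  have h := intervalIntegral.mul_integral_comp_mul_left (a := (0:ℝ)) (b := 1) (f := fun t : ℝ => g (s, t)) s
  simp only [mul_zero, mul_one] at h
  rw [intervalIntegral.integral_const_mul, h]

/-- **Duffy's transformation of the unit triangle onto the unit square**: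
`∫ q in unitTriangle, g q = ∫ u in 0..1, ∫ v in 0..1, u * g (u, u * v)` for `g` integrable on the triangle — a BOX
integral with the polynomial weight `u`. [cite: Duffy1982, p. 1260] [cite: DavisRabinowitz1984, Sect. 5.8] -/
theorem setIntegral_unitTriangle_eq_iterated_duffy {g : ℝ × ℝ → ℝ} (hg : IntegrableOn g unitTriangle) :
    ∫ q in unitTriangle, g q = ∫ u in (0:ℝ)..1, ∫ v in (0:ℝ)..1, u * g (u, u * v) := by
  rw [setIntegral_unitTriangle_eq_iterated hg]
  exact intervalIntegral.integral_congr fun u _ => integral_fibre_eq_integral_duffy g u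

/-! ### The affine parametrisation of a triangle -/

/-- Twice the signed area of the triangle `a b c`: the determinant of the pair of edge vectors `b - a`, `c - b`,
`(b₁ - a₁)(c₂ - b₂) - (c₁ - b₁)(b₂ - a₂)` (the constant Jacobian `ae - bd` of the affine map (5.4.7)).
[cite: DavisRabinowitz1984, Sect. 5.4 (5.4.7)-(5.4.8)] -/
def triangleDet (a b c : ℝ × ℝ) : ℝ := (b.1 - a.1) * (c.2 - b.2) - (c.1 - b.1) * (b.2 - a.2)

/-- The linear part of the affine parametrisation: the matrix with columns `b - a` and `c - b`.
[cite: DavisRabinowitz1984, Sect. 5.4 (5.4.7)-(5.4.8)] -/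
def triangleLinear (a b c : ℝ × ℝ) : ℝ × ℝ →L[ℝ] ℝ × ℝ :=
  (Matrix.toLin (.finTwoProd ℝ) (.finTwoProd ℝ) !![b.1 - a.1, c.1 - b.1; b.2 - a.2, c.2 - b.2]).toContinuousLinearMap

/-- The linear part in coordinates. [cite: DavisRabinowitz1984, Sect. 5.4 (5.4.7)-(5.4.8)] -/
theorem triangleLinear_apply (a b c q : ℝ × ℝ) :
    triangleLinear a b c q =
      ((b.1 - a.1) * q.1 + (c.1 - b.1) * q.2, (b.2 - a.2) * q.1 + (c.2 - b.2) * q.2) := by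
  simp [triangleLinear, Matrix.toLin_finTwoProd_apply]

/-- The linear part as a combination of the edge vectors: `q.1 • (b - a) + q.2 • (c - b)`.
[cite: DavisRabinowitz1984, Sect. 5.4 (5.4.7)-(5.4.8)] -/
theorem triangleLinear_apply_eq_smul (a b c q : ℝ × ℝ) :
    triangleLinear a b c q = q.1 • (b - a) + q.2 • (c - b) := by
  rw [triangleLinear_apply]
  ext <;> simp only [Prod.fst_add, Prod.snd_add, Prod.smul_fst, Prod.smul_snd, Prod.fst_sub, Prod.snd_sub,
    smul_eq_mul] <;> ring

/-- The Jacobian determinant of the affine map is the constant `triangleDet a b c` (Davis–Rabinowitz (5.4.8)).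
[cite: DavisRabinowitz1984, Sect. 5.4 (5.4.7)-(5.4.8)] -/
theorem det_triangleLinear (a b c : ℝ × ℝ) : (triangleLinear a b c).det = triangleDet a b c := by
  simp only [triangleLinear, LinearMap.det_toContinuousLinearMap, LinearMap.det_toLin, Matrix.det_fin_two_of,
    triangleDet]

/-- The affine parametrisation of the triangle `a b c` by the unit triangle:
`(s, t) ↦ a + s • (b - a) + t • (c - b)` (Davis–Rabinowitz (5.4.7): vertices `(0,0) ↦ a`, `(1,0) ↦ b`, `(1,1) ↦ c`).
[cite: DavisRabinowitz1984, Sect. 5.4 (5.4.7)-(5.4.8)] -/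
def triangleParam (a b c : ℝ × ℝ) (q : ℝ × ℝ) : ℝ × ℝ := a + q.1 • (b - a) + q.2 • (c - b)

/-- The parametrisation is the translate by `a` of its linear part. [cite: DavisRabinowitz1984, Sect. 5.4 (5.4.7)-(5.4.8)] -/
theorem triangleParam_eq (a b c q : ℝ × ℝ) : triangleParam a b c q = a + triangleLinear a b c q := by
  rw [triangleLinear_apply_eq_smul, triangleParam, add_assoc]

/-- The parametrisation as `(a + ·) ∘ triangleLinear a b c`. [cite: DavisRabinowitz1984, Sect. 5.4 (5.4.7)-(5.4.8)] -/
theorem triangleParam_eq_comp (a b c : ℝ × ℝ) :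
    triangleParam a b c = (fun p => a + p) ∘ (triangleLinear a b c) :=
  funext (triangleParam_eq a b c)

/-- The vertices: `(0, 0) ↦ a`, `(1, 0) ↦ b`, `(1, 1) ↦ c`. [cite: DavisRabinowitz1984, Sect. 5.4 (5.4.7)-(5.4.8)] -/
theorem triangleParam_vertices (a b c : ℝ × ℝ) :
    triangleParam a b c (0, 0) = a ∧ triangleParam a b c (1, 0) = b ∧ triangleParam a b c (1, 1) = c := by
  refine ⟨?_, ?_, ?_⟩ <;> ext <;> simp [triangleParam]

/-- The parametrisation is continuous. [cite: DavisRabinowitz1984, Sect. 5.4 (5.4.7)-(5.4.8)] -/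
theorem continuous_triangleParam (a b c : ℝ × ℝ) : Continuous (triangleParam a b c) := by
  unfold triangleParam; fun_prop

/-- The parametrisation has the constant derivative `triangleLinear a b c`.
[cite: DavisRabinowitz1984, Sect. 5.4 (5.4.7)-(5.4.8)] -/
theorem hasFDerivAt_triangleParam (a b c q : ℝ × ℝ) :
    HasFDerivAt (triangleParam a b c) (triangleLinear a b c) q := by
  rw [triangleParam_eq_comp]
  exact ((triangleLinear a b c).hasFDerivAt).const_add a

/-- For a non-degenerate triangle (`triangleDet a b c ≠ 0`) the parametrisation is injective (Cramer's rule).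
[cite: DavisRabinowitz1984, Sect. 5.4 (5.4.7)-(5.4.8)] -/
theorem injective_triangleParam {a b c : ℝ × ℝ} (hD : triangleDet a b c ≠ 0) :
    Function.Injective (triangleParam a b c) := by
  intro p q hpq
  simp only [triangleParam, Prod.ext_iff, Prod.fst_add, Prod.snd_add, Prod.smul_fst, Prod.smul_snd, Prod.fst_sub,
    Prod.snd_sub, smul_eq_mul] at hpq
  obtain ⟨h1, h2⟩ := hpq
  have e1 : (p.1 - q.1) * triangleDet a b c = 0 := by
    unfold triangleDet; linear_combination (c.2 - b.2) * h1 - (c.1 - b.1) * h2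
  have e2 : (p.2 - q.2) * triangleDet a b c = 0 := by
    unfold triangleDet; linear_combination (b.1 - a.1) * h2 - (b.2 - a.2) * h1
  exact Prod.ext (sub_eq_zero.1 ((mul_eq_zero.1 e1).resolve_right hD))
    (sub_eq_zero.1 ((mul_eq_zero.1 e2).resolve_right hD))

/-- **The image of the unit triangle is the closed triangle** `convexHull ℝ {a, b, c}` (for any three points,
degenerate or not): `a + s • (b - a) + t • (c - b)` with `0 ≤ t ≤ s ≤ 1` is the point at parameter `s` of the
segment from `a` to the point `b + (t/s) • (c - b)` of the segment `[b, c]`.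
[cite: DavisRabinowitz1984, Sect. 5.4 (5.4.7)-(5.4.8)] -/
theorem image_triangleParam_unitTriangle (a b c : ℝ × ℝ) :
    triangleParam a b c '' unitTriangle = convexHull ℝ {a, b, c} := by
  rw [convexHull_insert (insert_nonempty b {c}), convexHull_pair, convexJoin_singleton_left]
  ext p
  rw [mem_iUnion₂]
  constructor
  · rintro ⟨q, ⟨h0, hts, hs1⟩, rfl⟩
    -- the ratio `v = t / s` (or `0` at the collapsed vertex `s = 0`)
    obtain ⟨v, hv0, hv1, hv⟩ : ∃ v : ℝ, 0 ≤ v ∧ v ≤ 1 ∧ q.1 * v = q.2 := by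
      rcases eq_or_lt_of_le (h0.trans hts) with hs | hs
      · exact ⟨0, le_rfl, zero_le_one, by rw [mul_zero]; exact (le_antisymm (hs ▸ hts) h0).symm⟩
      · exact ⟨q.2 / q.1, div_nonneg h0 hs.le, (div_le_one hs).2 hts, mul_div_cancel₀ _ hs.ne'⟩
    refine ⟨b + v • (c - b), ?_, ?_⟩
    · rw [segment_eq_image' ℝ]
      exact ⟨v, ⟨hv0, hv1⟩, rfl⟩
    · rw [segment_eq_image' ℝ]
      refine ⟨q.1, ⟨h0.trans hts, hs1⟩, ?_⟩
      simp only [triangleParam, ← hv, mul_smul, smul_sub, smul_add]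
      abel
  · rintro ⟨y, hy, hp⟩
    rw [segment_eq_image' ℝ] at hy hp
    obtain ⟨v, ⟨hv0, hv1⟩, rfl⟩ := hy
    obtain ⟨u, ⟨hu0, hu1⟩, rfl⟩ := hp
    refine ⟨(u, u * v), ⟨mul_nonneg hu0 hv0, mul_le_of_le_one_right hu0 hv1, hu1⟩, ?_⟩
    simp only [triangleParam, mul_smul, smul_sub, smul_add]
    abel

/-- The closed triangle is compact. [cite: DavisRabinowitz1984, Sect. 5.2 (5.2.1)] -/
theorem isCompact_convexHull_triple (a b c : ℝ × ℝ) : IsCompact (convexHull ℝ ({a, b, c} : Set (ℝ × ℝ))) :=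
  (((Set.finite_singleton c).insert b).insert a).isCompact_convexHull ℝ

/-- A function continuous on the closed triangle is integrable on it. [cite: DavisRabinowitz1984, Sect. 5.2 (5.2.1)] -/
theorem _root_.ContinuousOn.integrableOn_convexHull_triple {a b c : ℝ × ℝ} {f : ℝ × ℝ → ℝ}
    (hf : ContinuousOn f (convexHull ℝ {a, b, c})) : IntegrableOn f (convexHull ℝ {a, b, c}) :=
  hf.integrableOn_compact (isCompact_convexHull_triple a b c)

/-! ### The change of variables -/

/-- The unit triangle has area `1 / 2`. [cite: DavisRabinowitz1984, Sect. 5.2 (5.2.1)] -/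
theorem volume_unitTriangle : volume unitTriangle = ENNReal.ofReal (1 / 2) := by
  have hfin : volume unitTriangle ≠ ⊤ := isCompact_unitTriangle.measure_lt_top.ne
  have hint : ∫ _ in unitTriangle, (1:ℝ) = 1 / 2 := by
    rw [setIntegral_unitTriangle_eq_iterated (continuousOn_const.integrableOn_unitTriangle (g := fun _ => (1:ℝ)))]
    simp only [intervalIntegral.integral_const, sub_zero, smul_eq_mul, mul_one, integral_id]
    norm_num
  rw [← ofReal_setIntegral_one_of_measure_ne_top hfin, hint]

/-- **The area of a triangle** in `ℝ × ℝ`: `volume (convexHull ℝ {a, b, c}) = |triangleDet a b c| / 2` (for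
degenerate triangles both sides vanish; no injectivity is needed for the measure of a linear image). The
`EuclideanSpace ℝ (Fin 2)` version is `Theil2006.volume_convexHull_triple` (op. cit. in the module docstring).
[cite: DavisRabinowitz1984, Sect. 5.4 (5.4.7)-(5.4.8)] -/
theorem volume_convexHull_triple_prod (a b c : ℝ × ℝ) :
    volume (convexHull ℝ ({a, b, c} : Set (ℝ × ℝ))) = ENNReal.ofReal (|triangleDet a b c| / 2) := by
  rw [← image_triangleParam_unitTriangle, triangleParam_eq_comp, Set.image_comp, Set.image_add_left,
    measure_preimage_add, Measure.addHaar_image_continuousLinearMap, volume_unitTriangle,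
    ← ENNReal.ofReal_mul (abs_nonneg _)]
  have hdet : LinearMap.det (triangleLinear a b c : ℝ × ℝ →ₗ[ℝ] ℝ × ℝ) = triangleDet a b c :=
    det_triangleLinear a b c
  rw [hdet]
  congr 1
  ring

/-- A degenerate triangle (`triangleDet a b c = 0`, collinear vertices) is a null set.
[cite: DavisRabinowitz1984, Sect. 5.4 (5.4.7)-(5.4.8)] -/
theorem volume_convexHull_triple_prod_of_det_eq_zero {a b c : ℝ × ℝ} (hD : triangleDet a b c = 0) :
    volume (convexHull ℝ ({a, b, c} : Set (ℝ × ℝ))) = 0 := by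
  rw [volume_convexHull_triple_prod, hD, abs_zero, zero_div, ENNReal.ofReal_zero]

/-- Over a degenerate triangle every integral vanishes. [cite: DavisRabinowitz1984, Sect. 5.4 (5.4.7)-(5.4.8)] -/
theorem setIntegral_convexHull_triple_of_det_eq_zero {a b c : ℝ × ℝ} (hD : triangleDet a b c = 0)
    (f : ℝ × ℝ → ℝ) : ∫ p in convexHull ℝ {a, b, c}, f p = 0 :=
  setIntegral_measure_zero f (volume_convexHull_triple_prod_of_det_eq_zero hD)

/-- **Affine change of variables onto the unit triangle** (non-degenerate case, no integrability hypothesis):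
`∫ p in convexHull ℝ {a, b, c}, f p = |triangleDet a b c| * ∫ q in unitTriangle, f (triangleParam a b c q)`.
[cite: DavisRabinowitz1984, Sect. 5.4 (5.4.7)-(5.4.8)] -/
theorem setIntegral_convexHull_triple_eq_setIntegral_unitTriangle {a b c : ℝ × ℝ} (hD : triangleDet a b c ≠ 0)
    (f : ℝ × ℝ → ℝ) :
    ∫ p in convexHull ℝ {a, b, c}, f p = |triangleDet a b c| * ∫ q in unitTriangle, f (triangleParam a b c q) := by
  rw [← image_triangleParam_unitTriangle,
    integral_image_eq_integral_abs_det_fderiv_smul volume measurableSet_unitTriangle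
      (fun q _ => (hasFDerivAt_triangleParam a b c q).hasFDerivWithinAt) (injective_triangleParam hD).injOn f]
  simp only [det_triangleLinear, smul_eq_mul]
  exact integral_const_mul _ _

/-- Integrability transfers along the affine map (non-degenerate case).
[cite: DavisRabinowitz1984, Sect. 5.4 (5.4.7)-(5.4.8)] -/
theorem integrableOn_convexHull_triple_iff {a b c : ℝ × ℝ} (hD : triangleDet a b c ≠ 0) (f : ℝ × ℝ → ℝ) :
    IntegrableOn f (convexHull ℝ {a, b, c}) ↔ IntegrableOn (fun q => f (triangleParam a b c q)) unitTriangle := by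
  rw [← image_triangleParam_unitTriangle,
    integrableOn_image_iff_integrableOn_abs_det_fderiv_smul volume measurableSet_unitTriangle
      (fun q _ => (hasFDerivAt_triangleParam a b c q).hasFDerivWithinAt) (injective_triangleParam hD).injOn f]
  simp only [det_triangleLinear, smul_eq_mul]
  have hD' : |triangleDet a b c| ≠ 0 := abs_ne_zero.2 hD
  constructor
  · intro h
    refine (h.const_mul |triangleDet a b c|⁻¹).congr (ae_of_all _ fun q => ?_)
    show |triangleDet a b c|⁻¹ * (|triangleDet a b c| * f (triangleParam a b c q)) = f (triangleParam a b c q)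
    rw [← mul_assoc, inv_mul_cancel₀ hD', one_mul]
  · intro h
    exact h.const_mul _

/-- **Integral over a triangle as an iterated integral over the unit triangle**: for any three points and `f`
integrable on `convexHull ℝ {a, b, c}`,
`∫ p in convexHull ℝ {a, b, c}, f p = |triangleDet a b c| * ∫ s in 0..1, ∫ t in 0..s, f (a + s • (b - a) + t • (c - b))`.
[cite: DavisRabinowitz1984, Sect. 5.4 (5.4.7)-(5.4.8)] [cite: DavisRabinowitz1984, Sect. 5.6.1 (5.6.1.1)] -/
theorem setIntegral_convexHull_triple_eq_iterated {a b c : ℝ × ℝ} {f : ℝ × ℝ → ℝ}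
    (hf : IntegrableOn f (convexHull ℝ {a, b, c})) :
    ∫ p in convexHull ℝ {a, b, c}, f p =
      |triangleDet a b c| * ∫ s in (0:ℝ)..1, ∫ t in (0:ℝ)..s, f (a + s • (b - a) + t • (c - b)) := by
  rcases eq_or_ne (triangleDet a b c) 0 with hD | hD
  · rw [setIntegral_convexHull_triple_of_det_eq_zero hD, hD, abs_zero, zero_mul]
  · rw [setIntegral_convexHull_triple_eq_setIntegral_unitTriangle hD,
      setIntegral_unitTriangle_eq_iterated ((integrableOn_convexHull_triple_iff hD f).1 hf)]
    rfl

/-- **Integral over a triangle as a BOX integral (affine map + Duffy's collapse)**: for any three points and `f`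
integrable on `convexHull ℝ {a, b, c}`,
`∫ p in convexHull ℝ {a, b, c}, f p = |triangleDet a b c| * ∫ u in 0..1, ∫ v in 0..1, u * f (a + u • (b - a) + (u * v) • (c - b))`.
[cite: Duffy1982, p. 1260] [cite: DavisRabinowitz1984, Sect. 5.4 (5.4.7)-(5.4.8)] [cite: DavisRabinowitz1984, Sect. 5.8] -/
theorem setIntegral_convexHull_triple_eq_iterated_duffy {a b c : ℝ × ℝ} {f : ℝ × ℝ → ℝ}
    (hf : IntegrableOn f (convexHull ℝ {a, b, c})) :
    ∫ p in convexHull ℝ {a, b, c}, f p =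
      |triangleDet a b c| * ∫ u in (0:ℝ)..1, ∫ v in (0:ℝ)..1, u * f (a + u • (b - a) + (u * v) • (c - b)) := by
  rcases eq_or_ne (triangleDet a b c) 0 with hD | hD
  · rw [setIntegral_convexHull_triple_of_det_eq_zero hD, hD, abs_zero, zero_mul]
  · rw [setIntegral_convexHull_triple_eq_setIntegral_unitTriangle hD,
      setIntegral_unitTriangle_eq_iterated_duffy ((integrableOn_convexHull_triple_iff hD f).1 hf)]
    rfl

/-- The continuous case of `setIntegral_convexHull_triple_eq_iterated`: no integrability side condition.
[cite: DavisRabinowitz1984, Sect. 5.4 (5.4.7)-(5.4.8)] [cite: DavisRabinowitz1984, Sect. 5.6.1 (5.6.1.1)] -/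
theorem setIntegral_convexHull_triple_eq_iterated_of_continuousOn {a b c : ℝ × ℝ} {f : ℝ × ℝ → ℝ}
    (hf : ContinuousOn f (convexHull ℝ {a, b, c})) :
    ∫ p in convexHull ℝ {a, b, c}, f p =
      |triangleDet a b c| * ∫ s in (0:ℝ)..1, ∫ t in (0:ℝ)..s, f (a + s • (b - a) + t • (c - b)) :=
  setIntegral_convexHull_triple_eq_iterated hf.integrableOn_convexHull_triple

/-- The continuous case of `setIntegral_convexHull_triple_eq_iterated_duffy`: the form consumed by certified box
cubature. [cite: Duffy1982, p. 1260] [cite: DavisRabinowitz1984, Sect. 5.8] -/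
theorem setIntegral_convexHull_triple_eq_iterated_duffy_of_continuousOn {a b c : ℝ × ℝ} {f : ℝ × ℝ → ℝ}
    (hf : ContinuousOn f (convexHull ℝ {a, b, c})) :
    ∫ p in convexHull ℝ {a, b, c}, f p =
      |triangleDet a b c| * ∫ u in (0:ℝ)..1, ∫ v in (0:ℝ)..1, u * f (a + u • (b - a) + (u * v) • (c - b)) :=
  setIntegral_convexHull_triple_eq_iterated_duffy hf.integrableOn_convexHull_triple

/-- **The standard simplex** `S₂ = convexHull ℝ {(0,0), (1,0), (0,1)}` (Davis–Rabinowitz (5.2.1)): for `f`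
integrable on it, the collapsed form `∫ p in S₂, f p = ∫ s in 0..1, ∫ t in 0..s, f (s - t, t)` and the box form
`∫ p in S₂, f p = ∫ u in 0..1, ∫ v in 0..1, u * f (u - u * v, u * v)`.
[cite: DavisRabinowitz1984, Sect. 5.2 (5.2.1)] [cite: Duffy1982, p. 1260] -/
theorem setIntegral_stdSimplex_two_eq_iterated {f : ℝ × ℝ → ℝ}
    (hf : IntegrableOn f (convexHull ℝ {((0:ℝ), (0:ℝ)), (1, 0), (0, 1)})) :
    (∫ p in convexHull ℝ {((0:ℝ), (0:ℝ)), (1, 0), (0, 1)}, f p = ∫ s in (0:ℝ)..1, ∫ t in (0:ℝ)..s, f (s - t, t)) ∧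
    (∫ p in convexHull ℝ {((0:ℝ), (0:ℝ)), (1, 0), (0, 1)}, f p =
      ∫ u in (0:ℝ)..1, ∫ v in (0:ℝ)..1, u * f (u - u * v, u * v)) := by
  have hD : triangleDet ((0:ℝ), (0:ℝ)) (1, 0) (0, 1) = 1 := by norm_num [triangleDet]
  have hpt : ∀ s t : ℝ,
      ((0:ℝ), (0:ℝ)) + s • (((1:ℝ), (0:ℝ)) - (0, 0)) + t • (((0:ℝ), (1:ℝ)) - (1, 0)) = (s - t, t) := by
    intro s t
    simp only [Prod.smul_mk, Prod.mk_sub_mk, Prod.mk_add_mk, smul_eq_mul, Prod.mk.injEq]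
    constructor <;> ring
  refine ⟨?_, ?_⟩
  · rw [setIntegral_convexHull_triple_eq_iterated hf, hD, abs_one, one_mul]
    simp only [hpt]
  · rw [setIntegral_convexHull_triple_eq_iterated_duffy hf, hD, abs_one, one_mul]
    simp only [hpt]

end Literature.MeasureTheory.Integral
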